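/-
Copyright (c) 2026 the pub-hodgecm-mathlib formalisation cell (harness21).  Prover seat hodgecm-mathlib-LH4-p12 (g9), req620 Track A «(D-RAM) FOUR-FRAME» squad
((β₂) road (R-36), β₂ WORD #28 (b) ∕ #30 «K6-(c) OFF→GEN JUNCTION», SHELL HALF, part 3: THE FOLDS — on an odd-`d` row cell the shell conjunct DROPS (inside) ∕ the literal set is EMPTY (terminal), in the (OFF)∕(ROW) letters' set currency), 2026-09-05.
-/
import Summits.HodgeConjecture.HodgeConjecture.Theorems.F0P3cDyRamRowCellShellOddD   -- (this seat) part 2: HEAD-in `latticeNearTransvShell_one_of_row_inside`, HEAD-term `not_latticeInLevel_one_of_row_terminal`; brings ★ p862869's junction via ★ FILE 10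
import HarnessLib

/-!
# Crux `H413`, line LH4 «(D-RAM) FOUR-FRAME» — the (β₂) road (R-36), K6-(c) «OFF→GEN JUNCTION», SHELL HALF (3): THE FOLDS — «ON AN ODD ROW CELL THE SHELL CONJUNCT DROPS INSIDE AND EMPTIES THE TERMINAL CELL» —
# on the odd-`d` live row `|lam − jE u₀₀| = |ϖE|^{2b+1}` (`ℓ₀ = 1`) a glued vertex INSIDE the cell range (`|μ − ρμ| ≤ |cc(α − ρα)|·|ϖE|^{b+2}`) is on BOTH shells `(1, M)`, a vertex of
# the TERMINAL cell (`|μ − ρμ| = |cc(α − ρα)|·|ϖE|^b`) is on NEITHER, and in between the shell token IS the digit condition `|e₀| = |ϖ|`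

Cell `hodgecm-mathlib` (D-0151), FLOOR 0, crux item H413 = `stmt-HodgeConjecture-24833`, route of record `HCCMUnconditional`; squad F0∕P3c∕LH4; lane
`--supports stmt-HodgeConjecture-24833 --as helper` (count-neutral; pays NO tier-0 row).  THEOREMS ONLY (no `def`, no instance, no notation, no `sorry`, default heartbeats);
★-only imports; states NO law; (β₂) stays a HYPOTHESIS.  DATUM-FREE: ★ (C1)'s line model `(M, jE, ρ, Θ, α)` (`ρ`, `Θ` commuting isometric involutions, `Fix ρ = jE(E)`, `ρα ≠ α`,
`|α| ≤ 1`, `|ϖ| = exp(−1)`, `|jE c| ≤ 1 ↔ |c| ≤ 1`), a cell scalar `cc = ρcc` with the CELL letters of ★ p863084 (`Y ∈ 𝒪_cc` Gram-primitive, `|Y| = |ϖE|^b`, `1 ≤ b`, `|cc| ≤ |ϖE|^b`),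
and SIZE tokens only — NO residue field, NO `|2|`, ANY `q`; plus ★ p862869's block frame (H₂ of unit determinant, `|h_W| = 1`) for the junction.  `|jE ϖ|` is never evaluated (types
RamK and RamM read the same statements: the odd-`d` live row is `|μ| = |ϖE|^{2b+1}` in both, LH4-p16 (g2) 00:32:42Z «`m = 4b + 2(d%2)`»).

WHY (β₂ WORD #28 (b) ∕ #30 «K6-(c)»; LH4-p16 (g2) 00:40:23Z «the ROW-cell shell lemma at ODD d — does a ★ exist?»; split 01:20:47Z with LH7-p10 (g3), who types the existence
half).  At even `d` (`ℓ₀ = 0`) ★ p863084 puts every row vertex strictly inside the anti-diagonal on level EXACTLY `0`.  At ODD `d` the shells ask level `1` on the row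
`|μ| = |ϖE|^{2b+1}`; by ★ `…UpperLineRayLetters` the level token is the size of the ray scalar (`|e₀|·|cc(α − ρα)| = |κ − ρκ|`, `κ = μ∕Y`), and `κ − ρκ = (B·P − A·Q)(α − ρα)∕(Y·ρY)`
in ★ p862572's `Fix ρ`-coordinates (`|Q| ∈ (|cc|·|ϖE|, |cc|]` by Gram-primitivity).  Three regimes, decided by `|B| = |μ − ρμ|∕|α − ρα|`:
* INSIDE `|μ − ρμ| ≤ |cc(α − ρα)|·|ϖE|^{b+2}` (lane B: `j + b + 2 ≤ jl`): `|A| = |ϖE|^{2b+1}`, `A·Q` dominates STRICTLY, `|ϖ|² < |e₀| ≤ |ϖ|`, so `|e₀| = |ϖ|`: ON both shells.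
* TERMINAL `|μ − ρμ| = |cc(α − ρα)|·|ϖE|^b`, `|cc| < |ϖE|^b` (lane B: `j + b = jl`): `B·P` dominates, `|e₀| = 1`: level EXACTLY `0`, on NEITHER shell.
* BOUNDARY (lane B: `j + b + 1 = jl`): the two tie, `|e₀| ≤ |ϖ|` varies — the shell token IS the digit condition `|e₀| = |ϖ|` (LH4-p19 (g3)'s `NX`).
THIS FILE (3), through ★ p862869's junction `exists_presentation_of_mem_levelSetDep` (block frame + ★ (C1) line model, cell `(j, b)` in the currency `cc = ϖE^j`, `lam ∈ 𝒪_j`):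
`levelSetDep_inter_shell_and_eq_of_row_inside` — INSIDE (`b ≤ j`, `|μ − ρμ| ≤ |ϖE^j(α − ρα)|·|ϖE|^{b+2}`) the subset cut out by `(Shell(ℓ₀, M) ∧ P L₃)` EQUALS the subset cut out by
`P L₃` (any trailing `P`, `M` under ★ FILE 10's letters); `levelSetDep_inter_shell_and_eq_empty_of_row_terminal` — TERMINAL (`b < j`, `|μ − ρμ| = |ϖE^j(α − ρα)|·|ϖE|^b`) it is `∅`.
HONEST LABEL.  Count-neutral valuation ∕ order algebra; nothing printed is asserted; no census law is stated; ‹ROW›∕‹ROW-ODD›∕‹CORE-*›∕‹FLIPT› and every (OFF) band letter stay OPEN;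
`HC_CM` is proved only modulo the 7 printed citations (2 remaining named inputs: hLiu418 = `stmt-HodgeConjecture-24832`, h413 = `stmt-HodgeConjecture-24833`) until rung 0 closes.
## References
* [Serre1979] J.-P. Serre, *Local Fields*, GTM 67 (1979): Ch. III §3 Prop. 7, Ch. III §6 Prop. 12 (orders of conductor `c`).
* [Jacobowitz1962] R. Jacobowitz, *Hermitian forms over local fields*, Amer. J. Math. 84 (1962): §4 (duals, Gram-primitivity, gluing).
* [Kottwitz1986BaseChangeUnits] R. E. Kottwitz, *Base change for unit elements of Hecke algebras*, Compositio Math. 60 (1986): §1 pp. 240–241, §3 (congruence levels).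
* [Rogawski1990] J. D. Rogawski, *Automorphic Representations of Unitary Groups in Three Variables*, Ann. of Math. Stud. 123 (1990): §4.9 Prop. 4.9.1 (b) p. 55.
-/

set_option autoImplicit false

noncomputable section

namespace Summit.HodgeConjecture.HodgeConjecture.Cruxes.H413.F0P3cDyRamRowCellShellOddDFold

open scoped Valued WithZero Matrix MatrixGroups
open WithZero
open Literature.NumberTheory.Automorphic Literature.NumberTheory.Automorphic.HermitianLattice Literature.NumberTheory.Automorphic.UnitaryLatticeTree
open Literature.NumberTheory.Rogawski1990
open Summit.HodgeConjecture.HodgeConjecture.Cruxes.H413.F0P3cDyRamToricCensusDefs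
open Summit.HodgeConjecture.HodgeConjecture.Cruxes.H413.F0P3cDyRamFourFrameCensusDefs (LatticeInLevel LatticeNearTransvShell)
open Summit.HodgeConjecture.HodgeConjecture.Cruxes.H413.F0P3cDyRamRowCellOnShell (uniformizer_letters)
open Summit.HodgeConjecture.HodgeConjecture.Cruxes.H413.F0P3cDyRamConeCellPresentation (exists_presentation_of_mem_levelSetDep)
open Summit.HodgeConjecture.HodgeConjecture.Cruxes.H413.F0P3cDyRamRowCellShellOddD (latticeNearTransvShell_one_of_row_inside not_latticeInLevel_one_of_row_terminal)

variable {E M : Type} [Field E] [Valued E ℤᵐ⁰] [Field M] [Valued M ℤᵐ⁰] {ρ Θ : M →+* M} {α : M}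

/-- **FOLD-in — «INSIDE AN ODD ROW CELL THE SHELL CONJUNCT DROPS OUT».**  ★ p862869's block frame + line model (`Fix ρ = jE(E)`, `|jE c| ≤ 1 ↔ |c| ≤ 1`); literal `(γ₂, u)`;
cone cell `(j, b)` with `1 ≤ b ≤ j`, `lam ∈ 𝒪_j`; ROW `|μ| = |ϖE|^{2b+1}` (`μ = lam − jE u₀₀`), INSIDE `|μ − ρμ| ≤ |ϖE^j(α − ρα)|·|ϖE|^{b+2}`; ★ FILE 10's letters at `M`
(`ℓ₀ + k = M`, `|u₀₀ − 1| ≤ |ϖ^k|`, `|μ| ≤ |ϖE|^k`, `|μ|·|μ − ρμ| ≤ |ϖE^j(α − ρα)|·|ϖE|^b·|ϖE|^M`) and the three cell-constant level-`2` letters; `ℓ₀ = 1`.  THEN for every `P`,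
`levelSetDep ∩ {∃ B, φB = Λ ∧ ∃ L₃, SD ∧ L₃ ∩ W = ι_W B ∧ tube_b ∧ (LatticeNearTransvShell ϖ ℓ₀ M (Γ − 1) L₃ ∧ P L₃)} = levelSetDep ∩ {∃ B, … ∧ tube_b ∧ P L₃}`.
[cite: Kottwitz1986BaseChangeUnits, §1 pp. 240–241; §3] [cite: Jacobowitz1962, §4] [cite: Rogawski1990, §4.9 Prop. 4.9.1 (b) p. 55] -/
theorem levelSetDep_inter_shell_and_eq_of_row_inside
    (σ : E →+* E) (hσ : ∀ a, σ (σ a) = a) (hvσ : ∀ a, Valued.v (σ a) = Valued.v a) {ϖ : E} (hϖ : Valued.v ϖ = exp (-1 : ℤ))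
    {H₂ : Matrix (Fin 2) (Fin 2) E} (hH₂ : IsUnit H₂.det) (hH₂σ : (H₂.map σ)ᵀ = H₂) {hW : E} (hhW : Valued.v hW = 1)
    (jE : E →+* M) (hρρ : ∀ x, ρ (ρ x) = x) (hvρ : ∀ x, Valued.v (ρ x) = Valued.v x) (hα : ρ α ≠ α) (hα1 : Valued.v α ≤ 1)
    (hint : ∀ z : M, Valued.v z ≤ 1 → Valued.v ((z - ρ z) / (α - ρ α)) ≤ 1)
    (hΘΘ : ∀ x, Θ (Θ x) = x) (hΘρ : ∀ x, Θ (ρ x) = ρ (Θ x)) (hvΘ : ∀ x, Valued.v (Θ x) = Valued.v x)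
    (hjv : ∀ c, Valued.v (jE c) ≤ 1 ↔ Valued.v c ≤ 1) (hjfix : ∀ z, ρ z = z ↔ ∃ c, jE c = z)
    (hjpow : ∀ (t : E) (n : ℤ), Valued.v (jE t) = Valued.v (jE ϖ) ^ n ↔ Valued.v t = Valued.v ϖ ^ n)
    (hϖmax : ∀ t : M, ρ t = t → Valued.v t < 1 → Valued.v t ≤ Valued.v (jE ϖ))
    (φ : (Fin 2 → E) →+ M) (hφs : ∀ (c : E) (x : Fin 2 → E), φ (c • x) = jE c * φ x) (hφi : Function.Injective φ) (hφo : Function.Surjective φ)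
    {γ₂ : GL (Fin 2) E} {lam h : M} (hφγ : ∀ x, φ ((γ₂ : Matrix (Fin 2) (Fin 2) E).mulVec x) = lam * φ x) (hlam : Valued.v lam = 1)
    (hΘh : Θ h = h) (hh : h ≠ 0) (hform : ∀ x y, jE (pairing σ H₂ x y) = h * Θ (φ x) * φ y + ρ (h * Θ (φ x) * φ y))
    (u : GL (Fin 1) E) (ℓ₀ : ℕ) (hℓ : ℓ₀ = 1) (k Ms : ℕ) (hmk : ℓ₀ + k = Ms)
    (huk : Valued.v ((u : Matrix (Fin 1) (Fin 1) E) 0 0 - 1) ≤ Valued.v (ϖ ^ k))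
    {b j : ℕ} (hb1 : 1 ≤ b) (hbj : b ≤ j) (hlamj : IsOrd ρ α (jE ϖ ^ j) lam)
    (hμ : Valued.v (lam - jE ((u : Matrix (Fin 1) (Fin 1) E) 0 0)) = Valued.v (jE ϖ) ^ (2 * b + 1))
    (hanti : Valued.v ((lam - jE ((u : Matrix (Fin 1) (Fin 1) E) 0 0)) - ρ (lam - jE ((u : Matrix (Fin 1) (Fin 1) E) 0 0))) ≤
      Valued.v (jE ϖ ^ j * (α - ρ α)) * Valued.v (jE ϖ) ^ (b + 2))
    (hμk : Valued.v (lam - jE ((u : Matrix (Fin 1) (Fin 1) E) 0 0)) ≤ Valued.v (jE ϖ) ^ k)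
    (hprod : Valued.v (lam - jE ((u : Matrix (Fin 1) (Fin 1) E) 0 0)) * Valued.v ((lam - jE ((u : Matrix (Fin 1) (Fin 1) E) 0 0)) - ρ (lam - jE ((u : Matrix (Fin 1) (Fin 1) E) 0 0))) ≤
      Valued.v (jE ϖ ^ j * (α - ρ α)) * Valued.v (jE ϖ) ^ b * Valued.v (jE ϖ) ^ Ms)
    (hul : Valued.v ((u : Matrix (Fin 1) (Fin 1) E) 0 0 - 1) ≤ Valued.v (ϖ ^ (1 + 1)))
    (hlam1 : Valued.v (lam - 1) ≤ Valued.v (jE ϖ) ^ (1 + 1))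
    (hlamρ : Valued.v (lam - ρ lam) ≤ Valued.v (jE ϖ ^ j * (α - ρ α)) * Valued.v (jE ϖ) ^ (1 + 1))
    (P : Submodule 𝒪[E] (Fin 3 → E) → Prop) :
    levelSetDep ρ Θ α (jE ϖ) h j b (lam - jE ((u : Matrix (Fin 1) (Fin 1) E) 0 0)) ∩
        {Λ | ∃ B : Submodule 𝒪[E] (Fin 2 → E), B.toAddSubgroup.map φ = Λ ∧
          ∃ L₃ : Submodule 𝒪[E] (Fin 3 → E), IsSelfDualLattice σ ϖ (!![H₂ 0 0, 0, H₂ 0 1; 0, hW, 0; H₂ 1 0, 0, H₂ 1 1] : Matrix (Fin 3) (Fin 3) E) L₃ ∧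
            L₃ ⊓ LinearMap.ker ((LinearMap.proj (1 : Fin 3) : (Fin 3 → E) →ₗ[E] E).restrictScalars 𝒪[E]) =
              B.map ((Matrix.toLin' (!![1, 0; 0, 0; 0, 1] : Matrix (Fin 3) (Fin 2) E)).restrictScalars 𝒪[E]) ∧
            (∀ c : E, (Pi.single 1 c : Fin 3 → E) ∈ L₃ ↔ Valued.v c ≤ Valued.v ϖ ^ b) ∧
            (LatticeNearTransvShell ϖ ℓ₀ Ms ((((endoGL (γ₂, u) : GL (Fin 3) E) : Matrix (Fin 3) (Fin 3) E) - 1)) L₃ ∧ P L₃)} =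
      levelSetDep ρ Θ α (jE ϖ) h j b (lam - jE ((u : Matrix (Fin 1) (Fin 1) E) 0 0)) ∩
        {Λ | ∃ B : Submodule 𝒪[E] (Fin 2 → E), B.toAddSubgroup.map φ = Λ ∧
          ∃ L₃ : Submodule 𝒪[E] (Fin 3 → E), IsSelfDualLattice σ ϖ (!![H₂ 0 0, 0, H₂ 0 1; 0, hW, 0; H₂ 1 0, 0, H₂ 1 1] : Matrix (Fin 3) (Fin 3) E) L₃ ∧
            L₃ ⊓ LinearMap.ker ((LinearMap.proj (1 : Fin 3) : (Fin 3 → E) →ₗ[E] E).restrictScalars 𝒪[E]) =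
              B.map ((Matrix.toLin' (!![1, 0; 0, 0; 0, 1] : Matrix (Fin 3) (Fin 2) E)).restrictScalars 𝒪[E]) ∧
            (∀ c : E, (Pi.single 1 c : Fin 3 → E) ∈ L₃ ↔ Valued.v c ≤ Valued.v ϖ ^ b) ∧ P L₃} := by
  subst hℓ
  obtain ⟨hϖ0, -, hjϖ0, hvjϖ0, hvjϖpos, hjϖlt, hjϖle⟩ := uniformizer_letters jE hjv hϖ
  have hρϖ : ρ (jE ϖ) = jE ϖ := (hjfix _).2 ⟨ϖ, rfl⟩
  have hc : ρ (jE ϖ ^ j) = jE ϖ ^ j := by rw [map_pow, hρϖ]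
  have hα0 : α - ρ α ≠ 0 := sub_ne_zero.2 (Ne.symm hα)
  have hcc : jE ϖ ^ j * (α - ρ α) ≠ 0 := mul_ne_zero (pow_ne_zero j hjϖ0) hα0
  have hcb : Valued.v (jE ϖ ^ j) ≤ Valued.v (jE ϖ) ^ b := by rw [Valuation.map_pow]; exact pow_le_pow_right_of_le_one' hjϖle hbj
  -- per member and glued vertex: INSIDE the shell `(1, M)` holds
  have key : ∀ Λ, Λ ∈ levelSetDep ρ Θ α (jE ϖ) h j b (lam - jE ((u : Matrix (Fin 1) (Fin 1) E) 0 0)) →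
      ∀ B : Submodule 𝒪[E] (Fin 2 → E), B.toAddSubgroup.map φ = Λ →
      ∀ L₃ : Submodule 𝒪[E] (Fin 3 → E), IsSelfDualLattice σ ϖ (!![H₂ 0 0, 0, H₂ 0 1; 0, hW, 0; H₂ 1 0, 0, H₂ 1 1] : Matrix (Fin 3) (Fin 3) E) L₃ →
        L₃ ⊓ LinearMap.ker ((LinearMap.proj (1 : Fin 3) : (Fin 3 → E) →ₗ[E] E).restrictScalars 𝒪[E]) =
          B.map ((Matrix.toLin' (!![1, 0; 0, 0; 0, 1] : Matrix (Fin 3) (Fin 2) E)).restrictScalars 𝒪[E]) →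
        (∀ c : E, (Pi.single 1 c : Fin 3 → E) ∈ L₃ ↔ Valued.v c ≤ Valued.v ϖ ^ b) →
        LatticeNearTransvShell ϖ 1 Ms ((((endoGL (γ₂, u) : GL (Fin 3) E) : Matrix (Fin 3) (Fin 3) E) - 1)) L₃ := by
    intro Λ hΛ B hBΛ L₃ hL hLB htube
    obtain ⟨x₀, w₀, g₀, hx₀, hΛx, hYO, hYprim, hylev, hw₀Y, hpr, hg₀, hg₀1, hprg⟩ :=
      exists_presentation_of_mem_levelSetDep σ hσ hvσ hϖ hH₂ hH₂σ hhW jE hρρ hvρ hα hα1 hint hΘΘ hΘρ hvΘ hjv hjfix hjpow hϖmax φ hφs hφi hφo hφγ hlam hΘh hh hform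
        ((u : Matrix (Fin 1) (Fin 1) E) 0 0) hb1 hlamj hΛ hBΛ hL hLB htube
    have hprod' : Valued.v (lam - jE ((u : Matrix (Fin 1) (Fin 1) E) 0 0)) *
        Valued.v ((lam - jE ((u : Matrix (Fin 1) (Fin 1) E) 0 0)) - ρ (lam - jE ((u : Matrix (Fin 1) (Fin 1) E) 0 0))) ≤
        Valued.v (jE ϖ ^ j * (α - ρ α)) * Valued.v (dualGen ρ Θ α (jE ϖ ^ j) h x₀) * Valued.v (jE ϖ) ^ Ms := by rw [hylev]; exact hprod
    exact latticeNearTransvShell_one_of_row_inside hρρ hvρ hΘΘ hΘρ hvΘ hα hα1 hϖ jE hjv hjfix φ hφs hφi hφγ hΘh htube hpr hLB.symm hg₀ hg₀1 hprg hBΛ hc hcc hx₀ hΛx hw₀Y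
      hYO hYprim hb1 hylev hcb u hμ hanti k Ms hmk huk hμk hprod' hul hlam1 hlamρ
  ext Λ
  constructor
  · rintro ⟨hΛ, B, hBΛ, L₃, hL, hLB, htube, -, hP⟩
    exact ⟨hΛ, B, hBΛ, L₃, hL, hLB, htube, hP⟩
  · rintro ⟨hΛ, B, hBΛ, L₃, hL, hLB, htube, hP⟩
    exact ⟨hΛ, B, hBΛ, L₃, hL, hLB, htube, key Λ hΛ B hBΛ L₃ hL hLB htube, hP⟩

/-- **FOLD-term — «THE TERMINAL CELL OF AN ODD ROW HAS NO VERTEX ON THE `ℓ₀ = 1` SHELL».**  Same frame; cone cell `(j, b)` with `1 ≤ b < j`, `lam ∈ 𝒪_j`; ROW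
`|μ| ≤ |ϖE|^{2b+1}`, TERMINAL `|μ − ρμ| = |ϖE^j(α − ρα)|·|ϖE|^b`; the three cell-constant level-`1` letters (`|u₀₀ − 1| ≤ |ϖ|`, `|lam − 1| ≤ |ϖE|`, `|lam − ρlam| ≤ |ϖE^j(α − ρα)|·|ϖE|`);
`ℓ₀ = 1`.  THEN for every square level `M` and every `P` the subset of `levelSetDep(j, b; μ)` cut out by `(LatticeNearTransvShell ϖ ℓ₀ M (Γ − 1) L₃ ∧ P L₃)` is `∅` (★ HEAD-term:
such vertices sit on level EXACTLY `0`). [cite: Kottwitz1986BaseChangeUnits, §1 pp. 240–241; §3] [cite: Jacobowitz1962, §4] [cite: Rogawski1990, §4.9 Prop. 4.9.1 (b) p. 55] -/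
theorem levelSetDep_inter_shell_and_eq_empty_of_row_terminal
    (σ : E →+* E) (hσ : ∀ a, σ (σ a) = a) (hvσ : ∀ a, Valued.v (σ a) = Valued.v a) {ϖ : E} (hϖ : Valued.v ϖ = exp (-1 : ℤ))
    {H₂ : Matrix (Fin 2) (Fin 2) E} (hH₂ : IsUnit H₂.det) (hH₂σ : (H₂.map σ)ᵀ = H₂) {hW : E} (hhW : Valued.v hW = 1)
    (jE : E →+* M) (hρρ : ∀ x, ρ (ρ x) = x) (hvρ : ∀ x, Valued.v (ρ x) = Valued.v x) (hα : ρ α ≠ α) (hα1 : Valued.v α ≤ 1)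
    (hint : ∀ z : M, Valued.v z ≤ 1 → Valued.v ((z - ρ z) / (α - ρ α)) ≤ 1)
    (hΘΘ : ∀ x, Θ (Θ x) = x) (hΘρ : ∀ x, Θ (ρ x) = ρ (Θ x)) (hvΘ : ∀ x, Valued.v (Θ x) = Valued.v x)
    (hjv : ∀ c, Valued.v (jE c) ≤ 1 ↔ Valued.v c ≤ 1) (hjfix : ∀ z, ρ z = z ↔ ∃ c, jE c = z)
    (hjpow : ∀ (t : E) (n : ℤ), Valued.v (jE t) = Valued.v (jE ϖ) ^ n ↔ Valued.v t = Valued.v ϖ ^ n)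
    (hϖmax : ∀ t : M, ρ t = t → Valued.v t < 1 → Valued.v t ≤ Valued.v (jE ϖ))
    (φ : (Fin 2 → E) →+ M) (hφs : ∀ (c : E) (x : Fin 2 → E), φ (c • x) = jE c * φ x) (hφi : Function.Injective φ) (hφo : Function.Surjective φ)
    {γ₂ : GL (Fin 2) E} {lam h : M} (hφγ : ∀ x, φ ((γ₂ : Matrix (Fin 2) (Fin 2) E).mulVec x) = lam * φ x) (hlam : Valued.v lam = 1)
    (hΘh : Θ h = h) (hh : h ≠ 0) (hform : ∀ x y, jE (pairing σ H₂ x y) = h * Θ (φ x) * φ y + ρ (h * Θ (φ x) * φ y))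
    (u : GL (Fin 1) E) (ℓ₀ : ℕ) (hℓ : ℓ₀ = 1) (Ms : ℕ)
    {b j : ℕ} (hb1 : 1 ≤ b) (hbj : b < j) (hlamj : IsOrd ρ α (jE ϖ ^ j) lam)
    (hμ : Valued.v (lam - jE ((u : Matrix (Fin 1) (Fin 1) E) 0 0)) ≤ Valued.v (jE ϖ) ^ (2 * b + 1))
    (hanti : Valued.v ((lam - jE ((u : Matrix (Fin 1) (Fin 1) E) 0 0)) - ρ (lam - jE ((u : Matrix (Fin 1) (Fin 1) E) 0 0))) =
      Valued.v (jE ϖ ^ j * (α - ρ α)) * Valued.v (jE ϖ) ^ b)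
    (hul : Valued.v ((u : Matrix (Fin 1) (Fin 1) E) 0 0 - 1) ≤ Valued.v (ϖ ^ 1))
    (hlam1 : Valued.v (lam - 1) ≤ Valued.v (jE ϖ) ^ 1)
    (hlamρ : Valued.v (lam - ρ lam) ≤ Valued.v (jE ϖ ^ j * (α - ρ α)) * Valued.v (jE ϖ) ^ 1)
    (P : Submodule 𝒪[E] (Fin 3 → E) → Prop) :
    levelSetDep ρ Θ α (jE ϖ) h j b (lam - jE ((u : Matrix (Fin 1) (Fin 1) E) 0 0)) ∩
        {Λ | ∃ B : Submodule 𝒪[E] (Fin 2 → E), B.toAddSubgroup.map φ = Λ ∧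
          ∃ L₃ : Submodule 𝒪[E] (Fin 3 → E), IsSelfDualLattice σ ϖ (!![H₂ 0 0, 0, H₂ 0 1; 0, hW, 0; H₂ 1 0, 0, H₂ 1 1] : Matrix (Fin 3) (Fin 3) E) L₃ ∧
            L₃ ⊓ LinearMap.ker ((LinearMap.proj (1 : Fin 3) : (Fin 3 → E) →ₗ[E] E).restrictScalars 𝒪[E]) =
              B.map ((Matrix.toLin' (!![1, 0; 0, 0; 0, 1] : Matrix (Fin 3) (Fin 2) E)).restrictScalars 𝒪[E]) ∧
            (∀ c : E, (Pi.single 1 c : Fin 3 → E) ∈ L₃ ↔ Valued.v c ≤ Valued.v ϖ ^ b) ∧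
            (LatticeNearTransvShell ϖ ℓ₀ Ms ((((endoGL (γ₂, u) : GL (Fin 3) E) : Matrix (Fin 3) (Fin 3) E) - 1)) L₃ ∧ P L₃)} = ∅ := by
  subst hℓ
  obtain ⟨hϖ0, -, hjϖ0, hvjϖ0, hvjϖpos, hjϖlt, hjϖle⟩ := uniformizer_letters jE hjv hϖ
  have hρϖ : ρ (jE ϖ) = jE ϖ := (hjfix _).2 ⟨ϖ, rfl⟩
  have hc : ρ (jE ϖ ^ j) = jE ϖ ^ j := by rw [map_pow, hρϖ]
  have hα0 : α - ρ α ≠ 0 := sub_ne_zero.2 (Ne.symm hα)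
  have hc0 : jE ϖ ^ j ≠ 0 := pow_ne_zero j hjϖ0
  have hcc : jE ϖ ^ j * (α - ρ α) ≠ 0 := mul_ne_zero hc0 hα0
  have hcb : Valued.v (jE ϖ ^ j) < Valued.v (jE ϖ) ^ b := by rw [Valuation.map_pow]; exact pow_lt_pow_right_of_lt_one₀ hvjϖpos hjϖlt hbj
  refine Set.subset_empty_iff.1 fun Λ hΛ => ?_
  obtain ⟨hΛ, B, hBΛ, L₃, hL, hLB, htube, hshell, -⟩ := hΛ
  obtain ⟨x₀, w₀, g₀, hx₀, hΛx, hYO, -, hylev, hw₀Y, hpr, hg₀, hg₀1, hprg⟩ :=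
    exists_presentation_of_mem_levelSetDep σ hσ hvσ hϖ hH₂ hH₂σ hhW jE hρρ hvρ hα hα1 hint hΘΘ hΘρ hvΘ hjv hjfix hjpow hϖmax φ hφs hφi hφo hφγ hlam hΘh hh hform
      ((u : Matrix (Fin 1) (Fin 1) E) 0 0) hb1 hlamj hΛ hBΛ hL hLB htube
  -- `|μ| ≤ |ϖE·Y|` on the row (`2b + 1 ≥ b + 1`)
  have hμl : Valued.v (lam - jE ((u : Matrix (Fin 1) (Fin 1) E) 0 0)) ≤ Valued.v (jE ϖ ^ 1 * dualGen ρ Θ α (jE ϖ ^ j) h x₀) := by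
    rw [Valuation.map_mul, Valuation.map_pow, hylev, ← pow_add]
    exact hμ.trans (pow_le_pow_right_of_le_one' hjϖle (by omega))
  exact not_latticeInLevel_one_of_row_terminal hρρ hvρ hΘΘ hΘρ hvΘ hα hα1 hϖ jE hjv hjfix φ hφs hφi hφγ hΘh htube hpr hLB.symm hg₀ hg₀1 hprg hBΛ hc hc0 hcc hx₀ hΛx hw₀Y
    hYO hylev hcb u hμ hanti hul hlam1 hlamρ hμl hshell.1

end Summit.HodgeConjecture.HodgeConjecture.Cruxes.H413.F0P3cDyRamRowCellShellOddDFold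

end
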